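import Literature.Analysis.FunctionSpaces.TorusSobolevNormProofs
import Literature.Analysis.FunctionSpaces.PoincareWirtingerConvex
import HarnessLib

/-!
# Parseval for absolutely summable functions on the lattice `ℤ^d`

Topic `Literature/Analysis/FunctionSpaces` (torus Fourier analysis). For `a ∈ ℓ¹(ℤ^d)` the
Fourier transform in the normalisation of lattice statistical mechanics,
`â(k) = Σ_{x ∈ ℤ^d} a(x) e^{i k·x}`, `k ∈ [-π,π]^d` (Madras–Slade 1993, (1.4.10)), satisfies
the Parseval relation

  `Σ_x |a(x)|² = ∫_{[-π,π]^d} |â(k)|² d^dk/(2π)^d`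

(Madras–Slade 1993, (1.5.5): `‖G_z(0,·)‖₂² = ‖Ĝ_z‖₂²`; Grafakos 2014, Prop. 3.2.7 (3) on the unit
torus). This file proves it in `[0, ∞]` (`Lattice.tsum_enorm_sq_eq_lintegral_cube`), by
transporting the tree's Plancherel theorem on `T^d = (ℝ/ℤ)^d`
(`Torus.tsum_enorm_sq_mFourierCoeff_eq_eLpNorm_sq`, Riesz–Fischer `Torus.exists_hasSum_toLp_mFourier_smul`)
along `k = 2πθ`.

## Contents (namespace `Literature.Analysis.FunctionSpaces`)

* `Torus.fourierSum c = Σ_n c_n e_n ∈ C(T^d, ℂ)` for `Σ_n ‖c_n‖ < ∞` (absolutely and uniformly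
  convergent), `Torus.hasSum_fourierSum`, `Torus.fourierSum_apply`,
  `Torus.mFourierCoeff_fourierSum` (its Fourier coefficients are the `c_n`),
  `Torus.tsum_enorm_sq_eq_lintegral_fourierSum` (`Σ ‖c_n‖² = ∫_{T^d} |Σ c_n e_n|²`),
  `Torus.fourierSum_coe_apply` (`(Σ c_n e_n)(θ mod 1) = Σ c_n e^{2πi n·θ}`),
  `Torus.lintegral_eq_lintegral_cube` (integration over `T^d` = over `(-1/2, 1/2]^d`);
* `Lattice.fourier a k = Σ_x a(x) e^{i k·x}` (complex families over any finite index type) and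
  **Parseval** `Lattice.tsum_enorm_sq_eq_lintegral_cube`:
  `Σ_x ‖a x‖ₑ² = (2π)^{-d} ∫⁻_{[-π,π]^d} ‖Lattice.fourier a k‖ₑ² dk` for `Σ_x ‖a x‖ < ∞`;
* (used: the tree's change of variables `Literature.Analysis.FunctionSpaces.lintegral_comp_smul`,
  `∫⁻ F(R v) dμ = |R ^ dim E|⁻¹ ∫⁻ F dμ`, from `PoincareWirtingerConvex.lean`).

The tree's earlier lattice transform `Literature.Barriers.CriticalPhenomena.latticeFT f k =
Σ_x f(x) e^{-ik·x}` (real `f` on `Site d`, Hara's sign; `LaceExpansionXSpaceAsymptotics.lean`) is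
`Lattice.fourier (f ·) (-k)`; that bridge (`latticeFT_eq_fourier_neg`) and Parseval for `latticeFT`
(`tsum_enorm_sq_eq_lintegral_latticeFT`) are proved in
`Literature/Barriers/CriticalPhenomena/LaceExpansionBubbleInfrared.lean`, which may import both
sides (this topic file does not import the barrier catalogue).

## Mathlib / tree search

Mathlib: `UnitAddTorus.mFourierBasis`, `hasSum_sq_mFourierCoeff` (Parseval for `Lp ℂ 2`, local
Haar volume), `hasSum_mFourier_series_of_summable` (from a function to its series, not
conversely), `Measure.map_addHaar_smul`, `Measure.integral_comp_smul` (Bochner only),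
`Measure.pi_Ioc_ae_eq_pi_Icc` (used for `(-π,π]^d =ᵐ [-π,π]^d`); nothing on `ℤ^d`-indexed
series over `[-π,π]^d` (searched `Parseval`, `mFourierCoeff`, `latticeFT`). Tree:
`Torus.exists_hasSum_toLp_mFourier_smul`, `Torus.tsum_enorm_sq_mFourierCoeff_eq_eLpNorm_sq`,
`Torus.mFourierCoeff_congr_ae`, `Torus.volume_eq_pi_haarAddCircle` (global `volume` convention);
`Literature.Barriers.CriticalPhenomena.latticeFT` (see above).

## References

* N. Madras, G. Slade, *The Self-Avoiding Walk*, Birkhäuser 1993, §1.4 (1.4.10) and §1.5 (1.5.5).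
* L. Grafakos, *Classical Fourier Analysis*, 3rd ed., GTM 249 (2014), Prop. 3.2.7 (3).
-/

open MeasureTheory Set Filter Topology UnitAddTorus
open scoped ENNReal NNReal Pointwise

noncomputable section

namespace Literature.Analysis.FunctionSpaces

namespace Torus

variable {d : Type*} [Fintype d]

/-! ## Absolutely convergent Fourier series on `T^d` -/

/-- The absolutely convergent Fourier series `Σ_n c_n e_n` of a family `c ∈ ℓ¹(ℤ^d)`, as a
continuous function on `T^d` (the `tsum` in the Banach space `C(T^d, ℂ)`; junk value `0` when
the series does not converge there). [cite: Grafakos2014, Prop. 3.2.7] -/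
def fourierSum (c : (d → ℤ) → ℂ) : C(UnitAddTorus d, ℂ) :=
  ∑' n, c n • mFourier n

/-- `Σ_n c_n e_n` converges (absolutely, in the sup norm) to `fourierSum c` when
`Σ ‖c_n‖ < ∞`, since `‖e_n‖_∞ = 1`. [folklore] -/
theorem hasSum_fourierSum {c : (d → ℤ) → ℂ} (hc : Summable fun n => ‖c n‖) :
    HasSum (fun n => c n • mFourier n) (fourierSum c) := by
  refine (Summable.of_norm ?_).hasSum
  simpa only [norm_smul, mFourier_norm, mul_one] using hc

/-- Pointwise: `(Σ_n c_n e_n)(t) = Σ_n c_n e_n(t)`. [folklore] -/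
theorem fourierSum_apply {c : (d → ℤ) → ℂ} (hc : Summable fun n => ‖c n‖)
    (t : UnitAddTorus d) : fourierSum c t = ∑' n, c n * mFourier n t := by
  rw [fourierSum, ← ContinuousMap.tsum_apply (hasSum_fourierSum hc).summable]
  simp only [ContinuousMap.smul_apply, smul_eq_mul]

omit [Fintype d] in
/-- `ℓ¹ ⊆ ℓ²`: `Σ ‖c_n‖ < ∞` implies `Σ ‖c_n‖² < ∞`. [folklore] -/
theorem summable_norm_sq_of_summable_norm {c : (d → ℤ) → ℂ} (hc : Summable fun n => ‖c n‖) :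
    Summable fun n => ‖c n‖ ^ 2 := by
  refine Summable.of_nonneg_of_le (fun n => sq_nonneg _) (fun n => ?_) (hc.mul_left (∑' m, ‖c m‖))
  rw [sq]
  exact mul_le_mul_of_nonneg_right (hc.le_tsum n fun m _ => norm_nonneg _) (norm_nonneg _)

/-- **The Fourier coefficients of `Σ_n c_n e_n` are the `c_n`** (`c ∈ ℓ¹(ℤ^d)`): the series also
converges in `L²(T^d)`, where Riesz–Fischer (`Torus.exists_hasSum_toLp_mFourier_smul`)
identifies the coefficients of the sum. [cite: Grafakos2014, Prop. 3.2.7 (4)] -/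
theorem mFourierCoeff_fourierSum {c : (d → ℤ) → ℂ} (hc : Summable fun n => ‖c n‖) (k : d → ℤ) :
    mFourierCoeff (fourierSum c) k = c k := by
  obtain ⟨g, hg, hcoeff, -⟩ :=
    exists_hasSum_toLp_mFourier_smul (F := ℂ) (summable_norm_sq_of_summable_norm hc)
  set T := ContinuousMap.toLp (E := ℂ) 2 (volume : Measure (UnitAddTorus d)) ℂ with hT
  have h1 : HasSum (fun n => T (c n • mFourier n)) (T (fourierSum c)) :=
    (hasSum_fourierSum hc).mapL T
  have h2 : ∀ n, T (c n • mFourier n) =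
      (memLp_mFourier_smul n (c n)).toLp (fun x : UnitAddTorus d => mFourier n x • c n) := by
    intro n
    refine Lp.ext ?_
    filter_upwards [ContinuousMap.coeFn_toLp (E := ℂ) (p := 2) (μ := volume) (𝕜 := ℂ)
      (c n • mFourier n), (memLp_mFourier_smul (F := ℂ) n (c n)).coeFn_toLp] with x hx hy
    rw [hT, hx, hy, ContinuousMap.smul_apply, smul_eq_mul, smul_eq_mul, mul_comm]
  simp_rw [h2] at h1
  have hgT : g = T (fourierSum c) := hg.unique h1
  rw [← hcoeff k, hgT, hT]
  exact (mFourierCoeff_congr_ae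
    (ContinuousMap.coeFn_toLp (E := ℂ) (p := 2) (μ := volume) (𝕜 := ℂ) (fourierSum c)) k).symm

/-- `‖f‖²_{L²} = ∫ ‖f‖²` in `[0, ∞]`. [folklore] -/
theorem eLpNorm_two_sq_eq_lintegral {α : Type*} [MeasurableSpace α] {μ : Measure α}
    (f : α → ℂ) : eLpNorm f 2 μ ^ 2 = ∫⁻ x, ‖f x‖ₑ ^ 2 ∂μ := by
  rw [eLpNorm_eq_lintegral_rpow_enorm_toReal two_ne_zero ENNReal.ofNat_ne_top, ENNReal.toReal_ofNat,
    ← ENNReal.rpow_natCast, ← ENNReal.rpow_mul]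
  norm_num

/-- **Plancherel for `Σ_n c_n e_n`**: `Σ_n ‖c_n‖² = ∫_{T^d} |Σ_n c_n e_n(t)|² dt` in `[0, ∞]`
(`c ∈ ℓ¹(ℤ^d)`). [cite: Grafakos2014, Prop. 3.2.7 (3)] -/
theorem tsum_enorm_sq_eq_lintegral_fourierSum {c : (d → ℤ) → ℂ} (hc : Summable fun n => ‖c n‖) :
    ∑' n, ‖c n‖ₑ ^ 2 = ∫⁻ t, ‖fourierSum c t‖ₑ ^ 2 := by
  have hmem : MemLp (fourierSum c) 2 (volume : Measure (UnitAddTorus d)) :=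
    MemLp.of_bound (fourierSum c).continuous.aestronglyMeasurable ‖fourierSum c‖
      (ae_of_all _ fun x => (fourierSum c).norm_coe_le_norm x)
  have h := tsum_enorm_sq_mFourierCoeff_eq_eLpNorm_sq hmem
  simp_rw [mFourierCoeff_fourierSum hc] at h
  rw [h, eLpNorm_two_sq_eq_lintegral]

/-- Evaluation of `Σ_n c_n e_n` at the class of `v ∈ ℝ^d`:
`(Σ_n c_n e_n)(v mod ℤ^d) = Σ_n c_n exp(2πi Σᵢ nᵢ vᵢ)`. [cite: Grafakos2014, §3.1.1] -/
theorem fourierSum_coe_apply {c : (d → ℤ) → ℂ} (hc : Summable fun n => ‖c n‖) (v : d → ℝ) :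
    fourierSum c (fun i => ((v i : ℝ) : UnitAddCircle)) =
      ∑' n : d → ℤ, c n * Complex.exp (2 * Real.pi * Complex.I * ∑ i, ((n i : ℝ) : ℂ) * (v i : ℂ)) := by
  rw [fourierSum_apply hc]
  refine tsum_congr fun n => ?_
  congr 1
  simp only [mFourier, ContinuousMap.coe_mk, fourier_coe_apply]
  rw [← Complex.exp_sum, Finset.mul_sum]
  congr 1
  refine Finset.sum_congr rfl fun i _ => ?_
  push_cast
  ring

/-- **Integration over `T^d` is integration over the fundamental domain `(-1/2, 1/2]^d`** (global
`volume`, transported from Mathlib's `UnitAddTorus.lintegral_preimage` for the local Haar volume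
along `Torus.volume_eq_pi_haarAddCircle`). [cite: Grafakos2014, §3.1.1] -/
theorem lintegral_eq_lintegral_cube (F : UnitAddTorus d → ℝ≥0∞) :
    ∫⁻ t, F t = ∫⁻ v in {v : d → ℝ | ∀ i, v i ∈ Ioc (-(1 / 2 : ℝ)) (-(1 / 2 : ℝ) + 1)},
      F (fun i => ((v i : ℝ) : UnitAddCircle)) :=
  (congrArg (fun μ : Measure (UnitAddTorus d) => ∫⁻ t, F t ∂μ)
    (volume_eq_pi_haarAddCircle (d := d))).trans (UnitAddTorus.lintegral_preimage F fun _ => -(1 / 2 : ℝ))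

end Torus

/-! ## Parseval on `ℤ^d` with the `[-π,π]^d` normalisation -/

namespace Lattice

variable {d : Type*} [Fintype d]

/-- The Fourier transform of a (summable) function on `ℤ^d` in the lattice normalisation,
`â(k) = Σ_{x ∈ ℤ^d} a(x) e^{i k·x}`, `k·x = Σⱼ kⱼ xⱼ`, as a `tsum` (junk value `0` where the series
does not converge). Complex-valued families over any finite index type `d`; the sign is that of
Madras–Slade (1.4.10) (the tree's `Literature.Barriers.CriticalPhenomena.latticeFT` is Hara's
`e^{-ik·x}` transform of a real `f` on `Site d`, i.e. this one at `-k`).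
[cite: MadrasSlade1993, §1.4, eq. (1.4.10)] -/
def fourier (a : (d → ℤ) → ℂ) (k : d → ℝ) : ℂ :=
  ∑' x : d → ℤ, a x * Complex.exp ((∑ j, k j * (x j : ℝ) : ℝ) * Complex.I)

/-- On the fundamental domain the torus series is the lattice transform at `k = 2πv`:
`(Σ_x a_x e_x)(v mod ℤ^d) = â(2πv)`. [folklore] -/
theorem fourierSum_coe_eq_fourier {a : (d → ℤ) → ℂ} (ha : Summable fun x => ‖a x‖) (v : d → ℝ) :
    Torus.fourierSum a (fun i => ((v i : ℝ) : UnitAddCircle)) = fourier a ((2 * Real.pi) • v) := by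
  rw [Torus.fourierSum_coe_apply ha, fourier]
  refine tsum_congr fun x => ?_
  congr 1
  congr 1
  simp only [Pi.smul_apply, smul_eq_mul]
  push_cast
  rw [Finset.mul_sum, Finset.sum_mul]
  refine Finset.sum_congr rfl fun i _ => ?_
  ring

/-- **Parseval on `ℤ^d`** (Madras–Slade 1993, (1.5.5); Grafakos 2014, Prop. 3.2.7 (3) transported
by `k = 2πθ`): for `Σ_x ‖a(x)‖ < ∞`,
`Σ_x ‖a(x)‖² = (2π)^{-d} ∫_{[-π,π]^d} ‖â(k)‖² dk`, in `[0, ∞]`.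
[cite: MadrasSlade1993, §1.5, eq. (1.5.5)] -/
theorem tsum_enorm_sq_eq_lintegral_cube {a : (d → ℤ) → ℂ} (ha : Summable fun x => ‖a x‖) :
    ∑' x, ‖a x‖ₑ ^ 2 = ENNReal.ofReal (((2 * Real.pi) ^ Fintype.card d)⁻¹) *
      ∫⁻ k in Set.pi Set.univ (fun _ : d => Icc (-Real.pi) Real.pi), ‖fourier a k‖ₑ ^ 2 := by
  have h2π : (2 * Real.pi : ℝ) ≠ 0 := by positivity
  set Q : Set (d → ℝ) := {v | ∀ i, v i ∈ Ioc (-(1 / 2 : ℝ)) (-(1 / 2 : ℝ) + 1)} with hQ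
  set Q' : Set (d → ℝ) := {k | ∀ i, k i ∈ Ioc (-Real.pi) Real.pi} with hQ'
  set G : (d → ℝ) → ℝ≥0∞ := fun k => ‖fourier a k‖ₑ ^ 2 with hG
  -- Plancherel on the torus, then down to the fundamental domain
  rw [Torus.tsum_enorm_sq_eq_lintegral_fourierSum ha, Torus.lintegral_eq_lintegral_cube]
  have hQm : MeasurableSet Q := by
    have : Q = Set.pi Set.univ fun _ : d => Ioc (-(1 / 2 : ℝ)) (-(1 / 2 : ℝ) + 1) := by
      ext v; simp only [hQ, mem_setOf_eq, mem_univ_pi]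
    rw [this]
    exact MeasurableSet.univ_pi fun _ => measurableSet_Ioc
  -- the integrand on `Q` is `G (2π • v)`; rescale
  have hind : ∀ v : d → ℝ, Q.indicator (fun v => ‖Torus.fourierSum a
      (fun i => ((v i : ℝ) : UnitAddCircle))‖ₑ ^ 2) v = Q'.indicator G ((2 * Real.pi) • v) := by
    intro v
    have hmem : v ∈ Q ↔ (2 * Real.pi) • v ∈ Q' := by
      simp only [hQ, hQ', mem_setOf_eq, Pi.smul_apply, smul_eq_mul, mem_Ioc]
      refine forall_congr' fun i => ?_
      constructor
      · rintro ⟨h1, h2⟩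
        constructor <;> nlinarith [Real.pi_pos]
      · rintro ⟨h1, h2⟩
        constructor <;> nlinarith [Real.pi_pos]
    by_cases hv : v ∈ Q
    · rw [indicator_of_mem hv, indicator_of_mem (hmem.1 hv), hG, fourierSum_coe_eq_fourier ha]
    · rw [indicator_of_notMem hv, indicator_of_notMem (fun h => hv (hmem.2 h))]
  have hQ'm : MeasurableSet Q' := by
    have : Q' = Set.pi Set.univ fun _ : d => Ioc (-Real.pi) Real.pi := by
      ext v; simp only [hQ', mem_setOf_eq, mem_univ_pi]
    rw [this]
    exact MeasurableSet.univ_pi fun _ => measurableSet_Ioc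
  rw [← lintegral_indicator hQm]
  simp_rw [hind]
  rw [lintegral_comp_smul volume (Q'.indicator G) h2π, lintegral_indicator hQ'm,
    Module.finrank_fintype_fun_eq_card, abs_of_pos (by positivity)]
  congr 1
  -- `(-π, π]^d` versus `[-π, π]^d` (Mathlib's `Measure.pi_Ioc_ae_eq_pi_Icc`)
  refine setLIntegral_congr ?_
  have hae : (Set.pi Set.univ fun _ : d => Ioc (-Real.pi) Real.pi) =ᵐ[volume]
      Set.pi Set.univ fun _ : d => Icc (-Real.pi) Real.pi := by
    rw [volume_pi]
    exact Measure.pi_Ioc_ae_eq_pi_Icc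
  refine (Filter.EventuallyEq.of_eq (Set.ext fun k => ?_)).trans hae
  rw [mem_setOf_eq, mem_univ_pi]

end Lattice

end Literature.Analysis.FunctionSpaces
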